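import Summits.ABC.IUTFork.Cor312SettingDHVolArch
import Summits.ABC.IUTFork.Cor312VolumesRealPrArch
import Summits.ABC.IUTFork.Cor312SettingPrVol
import HarnessLib

/-!
# [IUTchIII] Corollary 3.12, statement — the `Cor312.Setting` over the REAL log-shells with BOTH repairs: the
# PRINT-NORMALISED (probability-weighted) volumes at the primes AND an honest archimedean place

Record-only file (D-0012) of the abc-iut cell (wave-5 prover seat abc-iut-w5-d163 gen 2; TEAM A row A-0 NAMED
LEFTOVER (4) «archimedean radial container vs DH convention», PRINT-NORMALISED re-point — plan/C312-RESIDUALS.md §0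
«every VOLUME NUMBER must be read at the Pr-weighted setting to be print-normalised»); TAKES NO SIDE on [IUTchIII]
Cor. 3.12. `Cor312SettingDHVolArch` (this seat) assembled the setting of the printed statement of [IUTchIII] Cor. 3.12
(kurims `paper:url-4b091feeb646` p. 173 l. 41 – p. 174 l. 19) over `Real.situationDHVolArch`: c312-5's VERBATIM
Dupuy–Hilado-weighted container at the primes, abc-iut-L5-t7's radial/angular log-volume on the real archimedean
packet `M_I` at `∞` ([IUTchIV] Prop. 1.5 (iii)). abc-iut-w5-d043's `Cor312VolumesRealPrArch` MERGED the two repairs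
of the container — abc-iut-c312-1's probability weights `Pr(v⃗) = Π_a [F_{v_a}:ℚ_p]/[F:ℚ]^{j+1}` at the primes
(finding F-c312-1-g5-1: the printed normalisation sentence of [IUTchIII] Rmk. 3.1.1 (ii) p. 94 holds with these and
fails with the constant weights) and this seat's honest archimedean pieces — into `Real.situationDHVolPrArch`. THIS
file assembles the `Cor312.Setting` over it, with the SAME field factors, comparison and frames as
`Cor312SettingDHVolArch` (`factorIdxDHArch`/`factorFieldDHArch`/`factorMapDHArch`/`frameKDHArch` BY NAME — they do
not read the weights):

* `Real.realFramesPrArch : Setting.RealFrames (situationDHVolPrArch …)`;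
* **`Real.hadm_PrArch`** — hull-sets are ADMISSIBLE at every place (at a prime by c312-5's weight-free
  `adm_preimage_of_isHullSet` at c312-1's `presAtPr`; at `∞` as in `hadm_DHArch`: the pull-back of a polydisc of
  positive radii, `ArchPresentation.adm_preimage_polydisc`);
* **`Real.settingPrVolArch`** := `Setting.ofFrames …` — binders EXACTLY as in `settingDHVolArch`;
  `hul_nonempty_settingPrVolArch`; **`bridgeHyps_settingPrVolArch`** — c312-6's `BridgeHyps` with `mono`,
  `image_adm`, `image_fin`, `hul_nonempty`, `theta_nonempty` DISCHARGED (w5-d043 `bridgeHyps_PrArch`) and the same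
  three named residuals (`hθ`, `hfinθ`, `ThetaFinite`), discharged from box conditions in the sequels.
[claim: Mochizuki2012, status: disputed] for the quoted setting; [cite: DupuyHilado2025, Def. 3.6.1] at finite `p`;
[cite: Mochizuki2012, IUTchIV Prop. 1.5 (iii) p. 15] at `∞`. Deliberately NOT here: Θ-boxes, `HullDefined` /
`ThetaFinite` / `BridgeHyps` from box conditions (sequels `Cor312HullDefinedPrVolArch`, `Cor312ThetaLocalPrVolArch`,
`Cor312ThetaFinitePrVolArch`, `Cor312BridgeHypsPrVolArch`), any judgement.
-/

noncomputable section

open Set Function NumberField IsDedekindDomain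
open scoped Pointwise

namespace Summit.ABC

namespace IUTFork

namespace Thm311

namespace Real

open Cor312 Cor312Vol Literature.IUT.LogThetaLattice Literature.IUT.LogVolume Literature.IUT.LogVolume.Prop15iii

variable {F : Type} [Field F] [NumberField F] (X : PilotData F) {logv : PadicLogs F} (hlog : LogvAnalytic logv)
  (hc : ∀ w : InfinitePlace F, w.IsComplex)

section Setting

variable (M : Type) [Field M] [NumberField M]
  (archPk : ∀ (j : (thetaIndex X).Label) (vQ : (thetaIndex X).VQ), Set ((logShellsDH X logv).Packet j vQ))
  (archSub : ∀ (j : (thetaIndex X).Label) (v : (thetaIndex X).V),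
    Set ((logShellsDH X logv).Packet j ((thetaIndex X).over v)))
  (Ψ : ℤ → ∀ v : (thetaIndex X).V, v ∈ (thetaIndex X).Vbad → Set ((logShellsDH X logv).StarPacket v))
  (act : ℤ → ∀ v : (thetaIndex X).V, v ∈ (thetaIndex X).Vbad →
    (logShellsDH X logv).StarPacket v → Module.End ℚ ((logShellsDH X logv).StarPacket v))
  (Mmod : ℤ → ∀ j : (thetaIndex X).LabelStar, Set ((logShellsDH X logv).GlobalPacket j.1))
  (region : ℤ → ∀ j : (thetaIndex X).LabelStar, FinDivisor M → ∀ vQ : (thetaIndex X).VQ,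
    Set ((logShellsDH X logv).Packet j.1 vQ))

/-- **The real field-factor frames** of the setting over `Real.situationDHVolPrArch`: factors, comparison, frames,
and the two pilot binders (Θ-boxes, `q`-centre). [claim: Mochizuki2012, status: disputed] -/
def realFramesPrArch {ObLgp ObΔ : Type}
    (thetaBox : ℤ → ObLgp → ∀ (j : (thetaIndex X).Label) (vQ : (thetaIndex X).VQ),
      Set (∀ s : factorIdxDHArch X hlog j vQ, factorFieldDHArch X hlog j vQ s))
    (qCentre : ObΔ → ∀ (j : (thetaIndex X).Label) (vQ : (thetaIndex X).VQ),
      ∀ s : factorIdxDHArch X hlog j vQ, factorFieldDHArch X hlog j vQ s) :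
    Setting.RealFrames (situationDHVolPrArch X hlog hc M archPk archSub Ψ act Mmod region) ObLgp ObΔ where
  J := factorIdxDHArch X hlog
  instFintype := factorIdxDHArch_fintype X hlog
  K := factorFieldDHArch X hlog
  instField := factorFieldDHArch_field X hlog
  e := factorMapDHArch X hlog hc
  frameK := frameKDHArch X hlog
  hul_iff := frameKDHArch_hul_iff X hlog
  thetaBox := thetaBox
  qCentre := qCentre

/-- **`hadm` DISCHARGED for the real log-shells with the PRINT-NORMALISED volumes, archimedean place honest**: the preimage
of every hull-set `λ·𝒪_L` of every real packet is an admissible region of every line of `situationDHVolPrArch`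
([IUTchIII] Rmk. 3.9.5 (ii) "`λ·𝒪 ∈ 𝕄(𝓘^ℚ(−))`": at a prime by c312-5's `adm_preimage_of_isHullSet`; at `∞` the
polydisc of positive radii has positive finite volume, `ArchPresentation.adm_preimage_polydisc`).
[claim: Mochizuki2012, status: disputed] -/
theorem hadm_PrArch (n : ℤ) : ∀ (j : (thetaIndex X).Label) (vQ : (thetaIndex X).VQ)
    (H : Set (∀ s : factorIdxDHArch X hlog j vQ, factorFieldDHArch X hlog j vQ s)),
    IsHullSet (factorFieldDHArch X hlog j vQ) H →
      ((situationDHVolPrArch X hlog hc M archPk archSub Ψ act Mmod region).D n).Adm j vQ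
        (factorMapDHArch X hlog hc j vQ ⁻¹' H)
  | j, .inl u, H, hH => by
    cases u
    obtain ⟨c, hc0, rfl⟩ := hH
    show (archPresentationDH X logv hc).toLocalPieces.Adm j
      (factorMapDHArch X hlog hc j (.inl ()) ⁻¹' hullSet (factorFieldDHArch X hlog j (.inl ())) c)
    rw [factorMapDHArch_preimage_hullSet_inl]
    exact (archPresentationDH X logv hc).adm_preimage_of_adm j
      (ArchPresentation.adm_preimage_polydisc j fun s => norm_pos_iff.mpr (hc0 s))
  | j, .inr pp, H, hH => by
    haveI : Fact (pp : ℕ).Prime := ⟨pp.2⟩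
    exact (presAtPr X hlog pp).adm_preimage_of_isHullSet j hH

variable (n : ℤ) {HT : Type} {LogLink : HT → HT → Type} {IsFull : ∀ {s t : HT}, LogLink s t → Prop}
  (lat : LGPGaussianLogThetaLattice LogLink IsFull)
  {Frd : Type} {IsoF : Frd → Frd → Type} {Ob : Frd → Type} {realify : Frd → Frd} {Strip : Type}
  {IsoS : Strip → Strip → Type} {Mv : ∀ v : (thetaIndex X).V, v ∈ (thetaIndex X).Vbad → Type}
  [∀ v h, Monoid (Mv v h)]
  (sig : GlobalLGPFrobenioidSignature (thetaIndex X).lstar (thetaIndex X).V (· ∈ (thetaIndex X).Vbad)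
    Frd IsoF Ob realify Strip IsoS Mv)
  (split : SplittingMonoids Mv) {ObΔ : Type} {N : ∀ v : (thetaIndex X).V, v ∈ (thetaIndex X).Vbad → Type}
  [∀ v h, Monoid (N v h)] (qData : QPilotData ObΔ N)
  (thetaBox : ℤ → Ob sig.Clgp → ∀ (j : (thetaIndex X).Label) (vQ : (thetaIndex X).VQ),
    Set (∀ s : factorIdxDHArch X hlog j vQ, factorFieldDHArch X hlog j vQ s))
  (qCentre : ObΔ → ∀ (j : (thetaIndex X).Label) (vQ : (thetaIndex X).VQ),
    ∀ s : factorIdxDHArch X hlog j vQ, factorFieldDHArch X hlog j vQ s)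
  (hq : ∀ j vQ s, qCentre (qPilotObject qData) j vQ s ≠ 0)
  (hfin : ∀ j : (thetaIndex X).Label, (Function.support fun vQ =>
    ((situationDHVolPrArch X hlog hc M archPk archSub Ψ act Mmod region).D n).logvol j vQ
      (factorMapDHArch X hlog hc j vQ ⁻¹' hullSet (factorFieldDHArch X hlog j vQ) (qCentre (qPilotObject qData) j vQ))).Finite)

/-- **The setting of [IUTchIII] Cor. 3.12 over the REAL log-shells of `F` with the PRINT-NORMALISED volumes and an HONEST
archimedean place** (c312-7's per-frame assembler `Setting.ofFrames` at `Real.situationDHVolPrArch` with the real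
field-factor frames; `hadm` PROVED). Binders left as in c312-5's `settingDHVol` plus "`√−1 ∈ F`".
[claim: Mochizuki2012, status: disputed] -/
def settingPrVolArch : Cor312.Setting (situationDHVolPrArch X hlog hc M archPk archSub Ψ act Mmod region) :=
  Setting.ofFrames n lat sig split qData
    (realFramesPrArch X hlog hc M archPk archSub Ψ act Mmod region thetaBox qCentre)
    hq (hadm_PrArch X hlog hc M archPk archSub Ψ act Mmod region n) hfin

/-- The column of the assembled setting is `n`. [folklore] -/
theorem settingPrVolArch_n :
    (settingPrVolArch X hlog hc M archPk archSub Ψ act Mmod region n lat sig split qData thetaBox qCentre hq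
      hfin).n = n :=
  rfl

/-- **`hul_nonempty` DISCHARGED**: every hull-set of every frame of the assembled setting is nonempty (it is an
admissible region of the print-normalised container). [folklore] -/
theorem hul_nonempty_settingPrVolArch (j : (thetaIndex X).Label) (vQ : (thetaIndex X).VQ) :
    ∀ H ∈ ((settingPrVolArch X hlog hc M archPk archSub Ψ act Mmod region n lat sig split qData thetaBox qCentre hq
      hfin).frame j vQ).Hul, H.Nonempty := by
  rintro _ ⟨H', hH', rfl⟩
  have h := hadm_PrArch X hlog hc M archPk archSub Ψ act Mmod region n j vQ H'
    ((frameKDHArch_hul_iff X hlog j vQ H').mp hH')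
  exact SummandPieces.Adm.nonempty ((realizes_situationDHVolPrArch X hlog hc M archPk archSub Ψ act Mmod region
    n).adm_iff j vQ _ |>.1 h)

/-- **c312-6's `BridgeHyps` for the real setting with the print-normalised volumes and an honest archimedean place**, with
`mono`, `image_adm`, `image_fin`, `hul_nonempty`, `theta_nonempty` DISCHARGED: it remains to supply admissibility of
the (Ind3)-enlarged Θ-region at the labels `j ∈ 𝔽_l^⋇` (at a prime: a direct product over the summands of
positive-finite-measure sets; AT `∞`: positive finite volume in `⊕_{(w,ε)} ℂ`, e.g. the Step (vii) container —
`Real.adm_thetaContainer_arch`) with finitely supported log-volume, and `ThetaFinite`.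
[claim: Mochizuki2012, status: disputed] -/
theorem bridgeHyps_settingPrVolArch
    (hθ : ∀ (i : Fin (thetaIndex X).lstar) (vQ : (thetaIndex X).VQ),
      ((situationDHVolPrArch X hlog hc M archPk archSub Ψ act Mmod region).D n).Adm _ vQ
        ((settingPrVolArch X hlog hc M archPk archSub Ψ act Mmod region n lat sig split qData thetaBox qCentre hq
          hfin).thetaRegion3 (Setting.labelSucc i) vQ))
    (hfinθ : ∀ i : Fin (thetaIndex X).lstar, (Function.support fun vQ : (thetaIndex X).VQ =>
      ((situationDHVolPrArch X hlog hc M archPk archSub Ψ act Mmod region).D n).logvol _ vQ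
        ((settingPrVolArch X hlog hc M archPk archSub Ψ act Mmod region n lat sig split qData thetaBox qCentre hq
          hfin).thetaRegion3 (Setting.labelSucc i) vQ)).Finite)
    (finite : (settingPrVolArch X hlog hc M archPk archSub Ψ act Mmod region n lat sig split qData thetaBox qCentre
      hq hfin).ThetaFinite) :
    BridgeHyps (settingPrVolArch X hlog hc M archPk archSub Ψ act Mmod region n lat sig split qData thetaBox
      qCentre hq hfin) :=
  bridgeHyps_PrArch X hlog hc M archPk archSub Ψ act Mmod region _ hθ hfinθ
    (hul_nonempty_settingPrVolArch X hlog hc M archPk archSub Ψ act Mmod region n lat sig split qData thetaBox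
      qCentre hq hfin) finite

end Setting

end Real

end Thm311

end IUTFork

end Summit.ABC

end
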